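import Summits.AtomisticToContinuum.HydrodynamicLimit.Theorems.PolynomialCompression.Negative.PdeForm
import Summits.AtomisticToContinuum.HydrodynamicLimit.Theorems.PolynomialCompression.Negative.Statics
import Summits.AtomisticToContinuum.HydrodynamicLimit.Theorems.ImplosionDichotomyHsEosLowDensity

/-!
# Admissible `t = 0` data are the local-equilibrium density (line `r2-one-mode-two-conditions`, stub 1)

Stub `stub_admissibleData` of the registered skeleton `Cruxes/DenseExcursion/Lines/r2-one-mode-two-conditions.lean`
(crux `ImplosionDichotomy.DenseExcursion`, item stmt-AtomisticToContinuum-12586), PROVED.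

For continuous positive profiles `(a₀, u₀, θ₀)` and small `σ` the statement asks for a density `n` which is
`EosRelated σ a₀ n` — continuous, positive, on the dilute branch `n ≤ 2 a₀/∫a₀`, of unit mass, and solving the
bulk equation-of-state relation `log n(x) + βμ_ex(n(x) σ³) = log a₀(x) + const` with
`βμ_ex(η) = f_ex(η) + η f_ex'(η)`, `f_ex = hsExcessFreeEnergy` (the canonical free-volume `limsup` on `𝕋³`) —
and such that every field triple with `t = 0` data `(n, u₀, θ₀)` carries the law of large numbers of the local
Gibbs laws through every flow family. The witness is the tree's cluster-series density
`n = rhoLim (profileOf a₀) σ` (`HardSphereEulerLLN`):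

* §1 REDUCTION (`stub_admissibleData_of_eosIdentity`, adapted from the standing disprover's
  `Cruxes/DenseExcursion/Disproof.lean` §12): by the landed identified LLN `PolynomialCompressionPDE.lln_rhoLim`,
  its flow-free form `tendstoHydroFieldsAt_zero_iff_flowFree`, unit mass `PolynomialCompressionStatics.integral_rhoLim_eq_one`
  and the `O(σ³)` rate `abs_rhoLim_sub_β_le` (whence `rhoLim ≤ 2β`, `rhoLim_le_two_mul_β`), the stub follows from
  ONE deterministic identity, `EosIdentityForRhoLim`.
* §2 THE EXCESS CHEMICAL POTENTIAL IS THE LOG OF THE INSERTION FACTOR (`excessChemicalPotential_eq_log`): the landed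
  equation-of-state theorems of the line `log-lipschitz-budget` (crux `PolynomialCompression`) —
  `stub_eosRatioAnalytic` (analytic insertion factor `Rf`, `Rf x · Φ(x Rf x) = 1`, `Φ(u) = Σ_j bE j uʲ/j!`, unique
  root in `[1/2, 2]`), `stub_eosRatioUniform` + `stub_eosCesaro` (`-N⁻¹ log hsFreeVolume η N → ∫₀¹ log Rf(ηs) ds`) —
  give `hsExcessFreeEnergy η = η⁻¹ ∫₀^η log Rf` near every small `η > 0`, hence (fundamental theorem of calculus)
  `f_ex(η) + η f_ex'(η) = log Rf(η)`: the `deriv` in `excessChemicalPotential` is a genuine derivative there.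
* §3 THE IDENTITY (`eosIdentityForRhoLim`): with `R = ratioLimit`, `β = a₀/∫a₀`, `u = σ³ R β(x)`:
  `rhoLim = R β Φ(u)` and `rhoLim σ³ = u Φ(u)` termwise, `Φ(u) ∈ (1/2, 3/2)` (`SmallDensity.phi_lt_half`), so by
  uniqueness of the root `Rf(rhoLim σ³) = 1/Φ(u)` and `log rhoLim + log Rf(rhoLim σ³) = log R + log β`:
  the identity holds with constant `c = log R - log ∫a₀` (grand-canonical reading: `Rf = z/ρ = e^{βμ_ex}`).
* §4 `stub_admissibleData` — the registered signature, byte-identical; its hypothesis `HsEosLowDensity` (route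
  item stmt-0768, itself proved in `ImplosionDichotomyHsEosLowDensity`) is not even needed.

Sources: Ruelle 1969 §3.4 (canonical free energy), Lebowitz–Penrose 1964 (virial series), Pulvirenti–
Tsagkarogiannis 2012 (canonical cluster expansion), Spohn 1991 Part I §2.3 (local equilibrium LLN).
-/

noncomputable section

namespace Summit.AtomisticToContinuum.HydrodynamicLimit.Theorems.R2OneModeTwoConditions

open MeasureTheory Filter Set Topology
open Literature.MathematicalPhysics.KineticTheory Literature.Analysis.FluidPDE
open Summit.AtomisticToContinuum.HydrodynamicLimit.Theses.ImplosionDichotomy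
open PolynomialCompressionPDE PolynomialCompressionStatics DenseExcursionAtTimeZero

/-! ### §0 Definitions (VERBATIM from the skeleton `Lines/r2-one-mode-two-conditions.lean` §0) -/

/-- The excess chemical potential `β μ_ex(η) = f_ex(η) + η f_ex'(η)` of the hard-sphere fluid at reduced
density `η` (`f_ex = hsExcessFreeEnergy`; equals `(4π/3) η + O(η²)` where the virial series converges). -/
def excessChemicalPotential (η : ℝ) : ℝ :=
  hsExcessFreeEnergy η + η * deriv hsExcessFreeEnergy η

/-- `n` is the LOCAL-EQUILIBRIUM DENSITY of the activity profile `a₀` at reduced diameter `σ`: the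
continuous positive unit-mass solution of the bulk equation-of-state relation
`log n(x) + β μ_ex(n(x) σ³) = log a₀(x) + const` on the dilute branch `n ≤ 2 a₀/∫a₀` (which excludes
spurious roots in the range where `hsExcessFreeEnergy` is `limsup`/`deriv` junk). For small `σ` it is
unique, as smooth as `a₀`, and equals `n₀ - (4π/3) σ³ n₀ (n₀ - ∫ n₀²) + O(σ⁶)`, `n₀ = a₀/∫a₀` (the
canonical excluded-volume data defect; cdisprove §5b proves the two-sided `O(σ³)` bound). -/
def EosRelated (σ : ℝ) (a₀ n : T3 → ℝ) : Prop :=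
  Continuous n ∧ (∀ x, 0 < n x) ∧ (∀ x, n x ≤ 2 * (a₀ x / ∫ y, a₀ y)) ∧ (∫ x, n x) = 1 ∧
    ∃ c : ℝ, ∀ x, Real.log (n x) + excessChemicalPotential (n x * σ ^ 3) = Real.log (a₀ x) + c

/-- THE EQUATION-OF-STATE IDENTITY FOR THE CLUSTER-SERIES DENSITY: for every continuous positive activity
profile `a₀` and all small `σ`, the tree's limit density `rhoLim (profileOf a₀) σ` solves the bulk relation
`log n(x) + βμ_ex(n(x) σ³) = log a₀(x) + c` for some constant `c` (in fact `c = log ratioLimit - log ∫a₀`). The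
deterministic residual of the stub (Disproof §12); proved below (`eosIdentityForRhoLim`). -/
def EosIdentityForRhoLim : Prop :=
  ∀ (a₀ : T3 → ℝ) (ha : Continuous a₀) (ha0 : ∀ x, 0 < a₀ x), ∃ σ₀ : ℝ, 0 < σ₀ ∧ ∀ σ : ℝ, 0 < σ → σ < σ₀ →
    ∃ c : ℝ, ∀ x, Real.log (rhoLim (profileOf a₀ ha ha0) σ x) +
      excessChemicalPotential (rhoLim (profileOf a₀ ha ha0) σ x * σ ^ 3) = Real.log (a₀ x) + c

/-! ### §1 Reduction of the stub to `EosIdentityForRhoLim` -/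

-- adapted from `Cruxes/DenseExcursion/Disproof.lean` §12 (`rhoLim_le_two_mul_β`), on the landed rate
-- `PolynomialCompressionStatics.abs_rhoLim_sub_β_le`
/-- The dilute branch: `rhoLim ≤ 2β = 2 a₀/∫a₀` for small `σ` (from the `O(σ³)` statics rate
`|rhoLim - β| ≤ 16e²v₁M²σ³` and `min β > 0`). -/
theorem rhoLim_le_two_mul_β {a₀ : T3 → ℝ} (ha : Continuous a₀) (ha0 : ∀ x, 0 < a₀ x) :
    ∃ σ₂ : ℝ, 0 < σ₂ ∧ ∀ σ : ℝ, 0 < σ → σ < σ₂ → SmallDensity (profileOf a₀ ha ha0) σ →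
      ∀ x, rhoLim (profileOf a₀ ha ha0) σ x ≤ 2 * (a₀ x / ∫ y, a₀ y) := by
  set P := profileOf a₀ ha ha0 with hP
  obtain ⟨x₀, -, hx₀⟩ := isCompact_univ.exists_isMinOn univ_nonempty P.continuous.continuousOn
  have hβmin : ∀ y, P.β x₀ ≤ P.β y := fun y => (isMinOn_iff.mp hx₀) y (mem_univ y)
  set m := P.β x₀ with hm
  have hm0 : 0 < m := P.pos x₀
  set Cst := 16 * Real.exp 1 ^ 2 * v₁ * P.M ^ 2 with hCst
  have hC0 : 0 < Cst := by have := P.M_pos; have := v₁_pos; positivity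
  refine ⟨min 1 (m / Cst), lt_min one_pos (div_pos hm0 hC0), fun σ hσ hσlt hS x => ?_⟩
  have hσ1 : σ < 1 := lt_of_lt_of_le hσlt (min_le_left _ _)
  have hσm : σ < m / Cst := lt_of_lt_of_le hσlt (min_le_right _ _)
  have hσ3 : σ ^ 3 ≤ σ := by
    have e : σ ^ 3 = σ * (σ * σ) := by ring
    rw [e]; exact mul_le_of_le_one_right hσ.le (by nlinarith)
  have hrate := abs_rhoLim_sub_β_le hS x
  have h1 : rhoLim P σ x ≤ P.β x + Cst * σ ^ 3 := by
    have := (abs_sub_le_iff.1 hrate).1; rw [hCst]; linarith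
  have h2 : Cst * σ ^ 3 ≤ m := by
    calc Cst * σ ^ 3 ≤ Cst * σ := by gcongr
      _ ≤ Cst * (m / Cst) := by gcongr
      _ = m := mul_div_cancel₀ m hC0.ne'
  have h3 : m ≤ P.β x := hβmin x
  rw [← profileOf_β ha ha0 x]
  linarith

/-- **REDUCTION.** If the route item `HsEosLowDensity` yields the EOS identity for `rhoLim`, the stub holds: below
`min(σ₁, σ₂, σ₀)` (identified LLN `lln_rhoLim`, dilute branch `rhoLim_le_two_mul_β`, the identity) the witness
`n := rhoLim (profileOf a₀) σ` is continuous, positive, `≤ 2 a₀/∫a₀`, of unit mass (`integral_rhoLim_eq_one`) and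
EOS-related, and every field triple with `t = 0` slices `(n, u₀, θ₀)` is tied through every flow family because
the tie only sees the time-`0` slices (`tendstoHydroFieldsAt_zero_iff_flowFree`). -/
theorem stub_admissibleData_of_eosIdentity (hE : HsEosLowDensity → EosIdentityForRhoLim) :
    HsEosLowDensity →
    ∀ (a₀ θ₀ : T3 → ℝ) (u₀ : T3 → V3), Continuous a₀ → Continuous θ₀ → Continuous u₀ →
      (∀ x, 0 < a₀ x) → (∀ x, 0 < θ₀ x) →
      ∃ σ₀ : ℝ, 0 < σ₀ ∧ ∀ σ : ℝ, 0 < σ → σ < σ₀ →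
        ∃ n : T3 → ℝ, EosRelated σ a₀ n ∧
          ∀ (ρ θ : ℝ → T3 → ℝ) (u : ℝ → T3 → V3), ρ 0 = n → u 0 = u₀ → θ 0 = θ₀ →
            ∀ Φ : (N : ℕ) → Literature.Analysis.FluidPDE.HardSphereFlow
                (Literature.Analysis.FluidPDE.Torus.geometry (Fin 3)) (hsDiameter σ N) (N + 1),
              (∀ N, IsProbabilityMeasure (localGibbsLaw σ a₀ u₀ θ₀ N (Φ N))) ∧
              TendstoHydroFieldsAt (fun N => localGibbsLaw σ a₀ u₀ θ₀ N (Φ N)) Φ ρ u θ 0 := by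
  intro hZ a₀ θ₀ u₀ ha hθ hu ha0 hθ0
  obtain ⟨σa, hσa, -, Ha⟩ := lln_rhoLim ha hθ hu ha0 hθ0
  obtain ⟨σb, hσb, Hb⟩ := rhoLim_le_two_mul_β ha ha0
  obtain ⟨σc, hσc, Hc⟩ := hE hZ a₀ ha ha0
  refine ⟨min σa (min σb σc), lt_min hσa (lt_min hσb hσc), fun σ hσ hσlt => ?_⟩
  have hσa' : σ < σa := lt_of_lt_of_le hσlt (min_le_left _ _)
  have hσb' : σ < σb := lt_of_lt_of_le hσlt ((min_le_right _ _).trans (min_le_left _ _))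
  have hσc' : σ < σc := lt_of_lt_of_le hσlt ((min_le_right _ _).trans (min_le_right _ _))
  obtain ⟨hS, hpos, Hσ⟩ := Ha σ hσ hσa'
  obtain ⟨c, hc⟩ := Hc σ hσ hσc'
  refine ⟨rhoLim (profileOf a₀ ha ha0) σ, ⟨hS.continuous_rhoLim, fun x => hS.rhoLim_pos (hpos x),
    Hb σ hσ hσb' hS, integral_rhoLim_eq_one hS, c, hc⟩, ?_⟩
  intro ρ θ u hρ hu' hθ' Φ
  refine ⟨(Hσ Φ).1, ?_⟩
  -- (no expected type on `h2`: the slices `(fun _ => c) 0` beta-reduce on instantiation)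
  have h2 := (tendstoHydroFieldsAt_zero_iff_flowFree Φ).1 (Hσ Φ).2
  refine (tendstoHydroFieldsAt_zero_iff_flowFree Φ).2 ?_
  rw [hρ, hu', hθ']
  exact h2

/-! ### §2 The excess chemical potential is the logarithm of the insertion factor -/

/-- **`βμ_ex = log Rf` at small positive density.** There are `η₁ > 0` and a function `Rf` (the analytic
insertion factor of `stub_eosRatioAnalytic`) such that on `(0, η₁)`:
`excessChemicalPotential η = log Rf(η)` — because `hsExcessFreeEnergy η = η⁻¹ ∫₀^η log Rf` there
(`stub_eosRatioUniform`, `stub_eosCesaro`: the canonical free-volume limit exists and equals `∫₀¹ log Rf(ηs) ds`),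
so `f_ex + η f_ex' = log Rf` by the fundamental theorem of calculus — and `Rf x` is the unique root in `[1/2, 2]`
of `R · Φ(x R) = 1`, `Φ(u) = Σ_j bE j uʲ/j!`. -/
theorem excessChemicalPotential_eq_log :
    ∃ η₁ : ℝ, 0 < η₁ ∧ ∃ Rf : ℝ → ℝ,
      (∀ η ∈ Ioo 0 η₁, excessChemicalPotential η = Real.log (Rf η)) ∧
      (∀ x ∈ Ioo 0 η₁, ∀ R ∈ Icc (1 / 2 : ℝ) 2,
        R * (∑' j : ℕ, bE j / (j.factorial : ℝ) * (x * R) ^ j) = 1 → R = Rf x) := by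
  obtain ⟨r, hr, Rf, hps, h0, -, hsol, hbd, hLip, huniq⟩ := stub_eosRatioAnalytic
  -- the free-volume limit on `[0, η₂)` (glue as in `hsEosLowDensity_proof`)
  have hsol' : ∀ x ∈ Icc 0 (r / 2), 1 ≤ Rf x ∧ Rf x ≤ 2 ∧
      Rf x * (∑' j : ℕ, bE j / (j.factorial : ℝ) * (x * Rf x) ^ j) = 1 := by
    intro x hx
    have hx' : x ∈ Icc 0 r := ⟨hx.1, hx.2.trans (by linarith)⟩
    have hxo : x ∈ Ioo (-r) r := ⟨by linarith [hx.1], by linarith [hx.2]⟩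
    exact ⟨(hbd x hx').1, (hbd x hx').2, (hsol x hxo).2⟩
  have hLip' : ∃ L : NNReal, LipschitzOnWith L Rf (Icc 0 (r / 2)) := by
    obtain ⟨L, hL⟩ := hLip
    exact ⟨L, hL.mono (Icc_subset_Icc le_rfl (by linarith))⟩
  obtain ⟨η₂, hη₂, hη₂r, hunif⟩ := stub_eosRatioUniform Rf (r / 2) (by positivity) hsol' hLip'
  have hcontI : ContinuousOn Rf (Icc 0 (r / 2)) := by
    obtain ⟨L, hL⟩ := hLip'
    exact hL.continuousOn
  have hbd' : ∀ x ∈ Icc 0 (r / 2), 1 ≤ Rf x ∧ Rf x ≤ 2 := fun x hx => ⟨(hsol' x hx).1, (hsol' x hx).2.1⟩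
  have hlim : ∀ η ∈ Ico 0 η₂, Tendsto (fun N : ℕ => -(N : ℝ)⁻¹ * Real.log (hsFreeVolume η N)) atTop
      (𝓝 (∫ s in (0 : ℝ)..1, Real.log (Rf (η * s)))) := by
    intro η hη
    refine stub_eosCesaro Rf (r / 2) (by positivity) hcontI hbd' h0 η hη.1 (hη.2.trans_le hη₂r) ?_
    intro hηpos δ hδ
    exact hunif η ⟨hηpos, hη.2⟩ δ hδ
  -- `g := log ∘ Rf` is continuous on `(-r, r)`
  set g : ℝ → ℝ := fun t => Real.log (Rf t) with hg
  have hRfc : ContinuousOn Rf (Ioo (-r) r) := by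
    obtain ⟨p, hp⟩ := hps
    have := hp.continuousOn
    rwa [Metric.eball_ofReal, Real.ball_eq_Ioo, zero_sub, zero_add] at this
  have hgc : ContinuousOn g (Ioo (-r) r) := hRfc.log fun t ht => (hsol t ht).1.ne'
  -- `η F(η) = ∫₀^η g`
  have hF : ∀ η : ℝ, η * (∫ s in (0 : ℝ)..1, g (η * s)) = ∫ t in (0 : ℝ)..η, g t := by
    intro η
    have := intervalIntegral.smul_integral_comp_mul_left (f := g) (a := 0) (b := 1) η
    simpa only [smul_eq_mul, mul_zero, mul_one] using this
  refine ⟨η₂, hη₂, Rf, fun η hη => ?_, fun x hx R hR hfix => huniq x ⟨by linarith [hx.1], ?_⟩ R hR hfix⟩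
  · have hη0 : (0 : ℝ) < η := hη.1
    have hηr : η < r := by linarith [hη.2]
    have hηo : η ∈ Ioo (-r) r := ⟨by linarith, hηr⟩
    -- FTC
    have hGd : HasDerivAt (fun u => ∫ t in (0 : ℝ)..u, g t) (g η) η := by
      refine intervalIntegral.integral_hasDerivAt_right ?_ ?_ ?_
      · refine (hgc.mono ?_).intervalIntegrable
        rw [uIcc_of_le hη0.le]
        exact Icc_subset_Ioo (by linarith) hηr
      · exact hgc.stronglyMeasurableAtFilter isOpen_Ioo η hηo
      · exact hgc.continuousAt (isOpen_Ioo.mem_nhds hηo)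
    -- near `η`, `hsExcessFreeEnergy u = u⁻¹ ∫₀^u g`
    have hloc : hsExcessFreeEnergy =ᶠ[𝓝 η] fun u => u⁻¹ * ∫ t in (0 : ℝ)..u, g t := by
      filter_upwards [isOpen_Ioo.mem_nhds (show η ∈ Ioo 0 η₂ from hη)] with u hu
      rw [← hF u, ← mul_assoc, inv_mul_cancel₀ hu.1.ne', one_mul]
      unfold hsExcessFreeEnergy
      exact (hlim u ⟨hu.1.le, hu.2⟩).limsup_eq
    have hderiv : HasDerivAt hsExcessFreeEnergy
        (-(η ^ 2)⁻¹ * (∫ t in (0 : ℝ)..η, g t) + η⁻¹ * g η) η :=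
      ((hasDerivAt_inv hη0.ne').mul hGd).congr_of_eventuallyEq hloc
    have hval : hsExcessFreeEnergy η = η⁻¹ * ∫ t in (0 : ℝ)..η, g t := hloc.eq_of_nhds
    unfold excessChemicalPotential
    rw [hderiv.deriv, hval]
    have : η⁻¹ * (∫ t in (0 : ℝ)..η, g t) + η * (-(η ^ 2)⁻¹ * (∫ t in (0 : ℝ)..η, g t) + η⁻¹ * g η) = g η := by
      field_simp
      ring
    rw [this]
  · linarith [hx.2]

/-! ### §3 The cluster-series density solves the EOS identity -/

/-- Termwise bound of the insertion series at `0 ≤ u ≤ 2Mσ³`: `|bE j uʲ/j!| ≤ e θʲ`, `θ = geomRatio P σ = 2eMv₁σ³`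
(from `|bE j|/j! ≤ e (e v₁)ʲ`, `EosRatioAnalytic.abs_bE_div_factorial_le`). -/
theorem abs_phi_term_le {P : DensityProfile} {σ : ℝ} {u : ℝ} (hu0 : 0 ≤ u) (hu : u ≤ 2 * P.M * σ ^ 3)
    (j : ℕ) : |bE j / (j.factorial : ℝ) * u ^ j| ≤ Real.exp 1 * geomRatio P σ ^ j := by
  rw [abs_mul, abs_pow, abs_of_nonneg hu0]
  have hb := EosRatioAnalytic.abs_bE_div_factorial_le j
  have he : 0 < Real.exp 1 := Real.exp_pos 1
  have hv := v₁_pos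
  have hθ : Real.exp 1 * v₁ * u ≤ geomRatio P σ := by
    rw [geomRatio, ovDensity]
    calc Real.exp 1 * v₁ * u ≤ Real.exp 1 * v₁ * (2 * P.M * σ ^ 3) :=
          mul_le_mul_of_nonneg_left hu (by positivity)
      _ = 2 * Real.exp 1 * (P.M * v₁ * σ ^ 3) := by ring
  have h0 : 0 ≤ Real.exp 1 * v₁ * u := by positivity
  calc |bE j / (j.factorial : ℝ)| * u ^ j ≤ Real.exp 1 * (Real.exp 1 * v₁) ^ j * u ^ j := by gcongr
    _ = Real.exp 1 * (Real.exp 1 * v₁ * u) ^ j := by rw [mul_pow]; ring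
    _ ≤ Real.exp 1 * geomRatio P σ ^ j := by gcongr

/-- The insertion series is close to `1`: `|Φ(u) - 1| ≤ eθ/(1-θ)` for `0 ≤ u ≤ 2Mσ³` under `SmallDensity P σ`
(`bE 0 = 1` and the geometric tail). -/
theorem abs_phi_sub_one_le {P : DensityProfile} {σ : ℝ} (h : SmallDensity P σ) {u : ℝ} (hu0 : 0 ≤ u)
    (hu : u ≤ 2 * P.M * σ ^ 3) :
    |(∑' j : ℕ, bE j / (j.factorial : ℝ) * u ^ j) - 1| ≤
      Real.exp 1 * geomRatio P σ / (1 - geomRatio P σ) := by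
  have hθ0 := h.geomRatio_nonneg
  have hθ1 := h.geomRatio_lt_one
  have hsum : Summable fun j : ℕ => bE j / (j.factorial : ℝ) * u ^ j :=
    Summable.of_norm_bounded ((summable_geometric_of_lt_one hθ0 hθ1).mul_left _) fun j =>
      (Real.norm_eq_abs _).trans_le (abs_phi_term_le hu0 hu j)
  rw [hsum.tsum_eq_zero_add, EosRatioAnalytic.bE_zero, Nat.factorial_zero, Nat.cast_one, div_one, pow_zero,
    mul_one, add_sub_cancel_left]
  have hgeo : HasSum (fun j : ℕ => Real.exp 1 * geomRatio P σ ^ (j + 1))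
      (Real.exp 1 * geomRatio P σ / (1 - geomRatio P σ)) := by
    have h' := (hasSum_geometric_of_lt_one hθ0 hθ1).mul_left (Real.exp 1 * geomRatio P σ)
    rw [div_eq_mul_inv]
    refine h'.congr_fun fun j => ?_
    rw [pow_succ]; ring
  refine (Real.norm_eq_abs _).symm.trans_le (tsum_of_norm_bounded hgeo fun j => ?_)
  exact (Real.norm_eq_abs _).trans_le (abs_phi_term_le hu0 hu (j + 1))

/-- **The cluster series through the insertion series**: `rhoLim P σ x = R β(x) Φ(σ³ R β(x))`,
`R = ratioLimit P σ`, `Φ(u) = Σ_j bE j uʲ/j!` (termwise: `γ_j R^{j+1} β^{j+1} = Rβ · bE j (σ³Rβ)ʲ/j!`). -/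
theorem rhoLim_eq_mul_phi (P : DensityProfile) (σ : ℝ) (x : T3) :
    rhoLim P σ x = ratioLimit P σ * P.β x *
      ∑' j : ℕ, bE j / (j.factorial : ℝ) * (σ ^ 3 * ratioLimit P σ * P.β x) ^ j := by
  rw [rhoLim, ← tsum_mul_left]
  refine tsum_congr fun j => ?_
  rw [clusterCoeff, mul_pow, mul_pow]
  ring

/-- **THE EOS IDENTITY FOR `rhoLim`** (`EosIdentityForRhoLim`, unconditionally). For `σ` below the statics
threshold and with `rhoLim σ³ < η₁`: `u = σ³Rβ(x) ∈ [0, 2Mσ³]`, `Φ(u) ∈ (1/2, 3/2)` (`phi_lt_half`),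
`rhoLim σ³ = u Φ(u)` and `Φ(u)⁻¹ · Φ(rhoLim σ³ · Φ(u)⁻¹) = 1`, so `Rf(rhoLim σ³) = Φ(u)⁻¹` by uniqueness of the
root, and `log rhoLim + log Rf(rhoLim σ³) = log (Rβ Φ(u)) - log Φ(u) = log a₀(x) + (log R - log ∫a₀)`. -/
theorem eosIdentityForRhoLim : EosIdentityForRhoLim := by
  intro a₀ ha ha0
  obtain ⟨η₁, hη₁, Rf, hμ, huniq⟩ := excessChemicalPotential_eq_log
  set P := profileOf a₀ ha ha0 with hP
  obtain ⟨x₀, -, hx₀⟩ := isCompact_univ.exists_isMinOn univ_nonempty P.continuous.continuousOn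
  have hβmin : ∀ y, P.β x₀ ≤ P.β y := fun y => (isMinOn_iff.mp hx₀) y (mem_univ y)
  obtain ⟨σa, hσa, Ha⟩ := exists_smallDensity P (P.pos x₀)
  set K := (2 * Real.exp 1 + 1) * P.M with hK
  have hM := P.M_pos
  have hK0 : 0 < K := by positivity
  refine ⟨min σa (min 1 (η₁ / K)), lt_min hσa (lt_min one_pos (div_pos hη₁ hK0)), fun σ hσ hσlt => ?_⟩
  have hσa' : σ < σa := lt_of_lt_of_le hσlt (min_le_left _ _)
  have hσ1 : σ < 1 := lt_of_lt_of_le hσlt ((min_le_right _ _).trans (min_le_left _ _))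
  have hσK : σ < η₁ / K := lt_of_lt_of_le hσlt ((min_le_right _ _).trans (min_le_right _ _))
  obtain ⟨h, hposm⟩ := Ha σ hσ hσa'
  have hpos : ∀ x, 0 < rhoLim P σ x := fun x => h.rhoLim_pos (hposm.trans_le (hβmin x))
  have hR := h.ratioLimit_mem
  have hR0 := h.ratioLimit_pos
  have hint := integral_pos_of_continuous_pos ha ha0
  refine ⟨Real.log (ratioLimit P σ) - Real.log (∫ y, a₀ y), fun x => ?_⟩
  set R := ratioLimit P σ with hRdef
  set u := σ ^ 3 * R * P.β x with hu
  set Φu := ∑' j : ℕ, bE j / (j.factorial : ℝ) * u ^ j with hΦu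
  have hβ0 : 0 < P.β x := P.pos x
  have hu0 : 0 ≤ u := by positivity
  have huM : u ≤ 2 * P.M * σ ^ 3 := by
    have h1 : R * P.β x ≤ 2 * P.M := mul_le_mul hR.2 (P.le_M x) hβ0.le zero_le_two
    have hσ3 : 0 ≤ σ ^ 3 := by positivity
    calc u = σ ^ 3 * (R * P.β x) := by rw [hu]; ring
      _ ≤ σ ^ 3 * (2 * P.M) := by gcongr
      _ = 2 * P.M * σ ^ 3 := by ring
  have hΦ1 := abs_phi_sub_one_le h hu0 huM
  rw [← hΦu, abs_le] at hΦ1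
  have hφ := h.phi_lt_half
  have hΦlo : 1 / 2 < Φu := by linarith [hΦ1.1]
  have hΦhi : Φu < 3 / 2 := by linarith [hΦ1.2]
  have hΦpos : 0 < Φu := by linarith
  have hΦmem : Φu⁻¹ ∈ Icc (1 / 2 : ℝ) 2 := by
    constructor
    · rw [le_inv_comm₀ (by norm_num) hΦpos]; linarith
    · rw [inv_le_comm₀ hΦpos (by norm_num)]; linarith
  have hn : rhoLim P σ x = R * P.β x * Φu := rhoLim_eq_mul_phi P σ x
  have hnσ : rhoLim P σ x * σ ^ 3 = u * Φu := by rw [hn, hu]; ring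
  -- `rhoLim σ³ ∈ (0, η₁)`
  have hmem : rhoLim P σ x * σ ^ 3 ∈ Ioo 0 η₁ := by
    refine ⟨mul_pos (hpos x) (pow_pos hσ 3), ?_⟩
    have h1 : rhoLim P σ x < K := rhoLim_lt h x
    have hσ3 : σ ^ 3 ≤ σ := by
      have e : σ ^ 3 = σ * (σ * σ) := by ring
      rw [e]; exact mul_le_of_le_one_right hσ.le (by nlinarith)
    calc rhoLim P σ x * σ ^ 3 ≤ K * σ ^ 3 :=
          mul_le_mul_of_nonneg_right h1.le (pow_pos hσ 3).le
      _ ≤ K * σ := by gcongr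
      _ < K * (η₁ / K) := by gcongr
      _ = η₁ := mul_div_cancel₀ η₁ hK0.ne'
  -- uniqueness of the root: `Rf (rhoLim σ³) = Φ(u)⁻¹`
  have hRf : Φu⁻¹ = Rf (rhoLim P σ x * σ ^ 3) := by
    refine huniq _ hmem _ hΦmem ?_
    rw [hnσ, show u * Φu * Φu⁻¹ = u from mul_inv_cancel_right₀ hΦpos.ne' u, ← hΦu]
    exact inv_mul_cancel₀ hΦpos.ne'
  rw [hμ _ hmem, ← hRf, hn, Real.log_inv, Real.log_mul (by positivity) hΦpos.ne',
    Real.log_mul hR0.ne' hβ0.ne', profileOf_β ha ha0 x, Real.log_div (ha0 x).ne' hint.ne']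
  ring

/-! ### §4 The registered stub -/

/-- **STUB 1 of the line `r2-one-mode-two-conditions` (`stub_admissibleData`), PROVED**: for continuous positive
profiles and small `σ`, the local-equilibrium density `n = n^σ[a₀]` of `EosRelated` exists (it is the cluster-series
density `rhoLim (profileOf a₀) σ`) and the canonical local Gibbs laws are probability measures whose empirical
density / momentum / energy fields at `t = 0` satisfy the law of large numbers towards `(n, n u₀, n(|u₀|²/2 + 3θ₀/2))`
for every flow family — hence every field triple with these `t = 0` values carries the admissibility tie of
`DenseExcursion`. The hypothesis `HsEosLowDensity` (route item stmt-0768) is not used: the EOS identity is proved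
outright (`eosIdentityForRhoLim`). Sources: Ruelle1969 §3.4, LebowitzPenrose1964, Spohn1991 Part I Ch. 2–3,
PulvirentiTsagkarogiannis2012. -/
theorem stub_admissibleData :
    HsEosLowDensity →
    ∀ (a₀ θ₀ : T3 → ℝ) (u₀ : T3 → V3), Continuous a₀ → Continuous θ₀ → Continuous u₀ →
      (∀ x, 0 < a₀ x) → (∀ x, 0 < θ₀ x) →
      ∃ σ₀ : ℝ, 0 < σ₀ ∧ ∀ σ : ℝ, 0 < σ → σ < σ₀ →
        ∃ n : T3 → ℝ, EosRelated σ a₀ n ∧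
          ∀ (ρ θ : ℝ → T3 → ℝ) (u : ℝ → T3 → V3), ρ 0 = n → u 0 = u₀ → θ 0 = θ₀ →
            ∀ Φ : (N : ℕ) → Literature.Analysis.FluidPDE.HardSphereFlow
                (Literature.Analysis.FluidPDE.Torus.geometry (Fin 3)) (hsDiameter σ N) (N + 1),
              (∀ N, IsProbabilityMeasure (localGibbsLaw σ a₀ u₀ θ₀ N (Φ N))) ∧
              TendstoHydroFieldsAt (fun N => localGibbsLaw σ a₀ u₀ θ₀ N (Φ N)) Φ ρ u θ 0 :=
  stub_admissibleData_of_eosIdentity fun _ => eosIdentityForRhoLim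

end Summit.AtomisticToContinuum.HydrodynamicLimit.Theorems.R2OneModeTwoConditions

end
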